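import Summits.AtomisticToContinuum.BoseEinsteinCondensation.Theses.BECInfraredBound

/-!
# Birth skeleton (BC3) for crux `BecDepletionCounting` — stmt-AtomisticToContinuum-9034
(route `BECInfraredBound`, rank 9 = glue piece 3/3 of the pointwise-in-`v` mode counting;
sub-problem `BoseEinsteinCondensation`)

Planner `planner-skel-stmt-AtomisticToContinuum-9034-0`, 2026-08-17 (skeleton-register, re-audit bin
REPAIRABLE). Published as `Cruxes/BecDepletionCounting/Lines/birth.lean`.

The crux: for every admissible `v`, (inner-box depletion `Σ'_{k≠0} ⟨φ'_k, γ_Ψ φ'_k⟩ ≤ θN`, `θ < 1`,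
at every margin `ε`) → (no boundary accumulation `N_shell(ε) ≤ CεN`, `C` before `ε`) → X_B1 for `v`
(full-box zero mode `φ₀ = L^{-3/2} 1_Λ` carries `≥ cN` on all `δ`-near-minimisers, all small `ρ`).
It is the Parseval / sum-rule step of Dyson–Lieb–Simon mode counting in continuum inner-box form, and
the skeleton cuts it exactly at its two analytic facts, each stated DETERMINISTICALLY (every `N`, every
box side `L > 0`, every margin `ε ∈ (0,1/4)`, every trial state — no filters, no near-minimiser
hypothesis, no `v`):

* `stub_innerSumRule : InnerSumRule` — the INNER-BOX SUM RULE (completeness of the plane-wave ONB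
  `(φ'_k)_{k∈ℤ³}` of `L²(Λ')`, `Λ' = (εL, L−εL)³`, inside `occupation`, plus Bose symmetry):
  `⟨φ'_0,γφ'_0⟩ + Σ'_{k≠0}⟨φ'_k,γφ'_k⟩ + N_shell = N` — zero mode, non-zero modes and the shell mass
  (`Σ_i ∫ 1[x_i ∉ Λ'] |Ψ|²`) exhaust the particle number. Size M–L in Lean (3-D Fourier series on a
  translated cube for the Bochner pairing inside `occupation`, `lintegral_tsum`, `Fin.cons` Fubini).
* `stub_shellTransfer : ShellTransfer` — the SHELL TRANSFER (seminorm step): `√occupation` is a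
  seminorm in the mode, `φ₀ = (1−2ε)^{3/2} φ'_0 + w` with `w = L^{-3/2} 1_{Λ∖Λ'}`, and Cauchy–Schwarz on
  the shell gives `⟨w,γw⟩ ≤ L^{-3}|Λ∖Λ'|·N_shell ≤ 6ε N_shell`; squared out:
  `(1−2ε)³ ⟨φ'_0,γφ'_0⟩ ≤ 2⟨φ₀,γφ₀⟩ + 12ε N_shell`. Size M in Lean (Minkowski in `L²(dY)`, set algebra
  of the two cubes, Bose symmetry `Σ_i = N·(i = 0)`).

Composition `BecDepletionCounting_of : InnerSumRule → ShellTransfer → BecDepletionCounting` (hypotheses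
spelled `__Registered.stub_X`, `rfl`-aliases keyed by the stub names, for the native skeleton audit) is
PROVED below without `sorry`: choice of the margin `ε = min(1/8, (1−θ⁺)/(16C))`, `ρ₀ = min`, `δ = min`,
intersection of the two eventualities, the two stubs at `L = (N/ρ)^{1/3}`, and the real arithmetic
`⟨φ₀,γφ₀⟩ ≥ ½[(1−2ε)³(1−θ⁺−Cε) − 12Cε²]N ≥ (1−θ⁺)N/8` after passing from `ℝ≥0∞` to `ℝ`
(lemma `zeroMode_lower_arith`). It concludes the route decl
`Summit.AtomisticToContinuum.BoseEinsteinCondensation.Theses.BECInfraredBound.BecDepletionCounting` BY NAME.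

Disproof used: none relevant (no `Cruxes/BecDepletionCounting/Disproof.lean`, no landed Negative lemma,
`ledger crux ls` empty on 2026-08-17; `ledger negatives --problem AtomisticToContinuum`: 20 entries, none on
sum rules / occupations of box modes). Degenerate audit: `N = 0` — `occupation 0 = 0`, empty `Fin 0` sum,
both stubs read `0 = 0` / `0 ≤ 0`; the composition only uses `N ≥ 1`. `L ≤ 0` excluded by hypothesis
(and `TrialState N L` is empty there for `N ≥ 1`). `θ ≤ 0` is absorbed by `θ⁺ = max θ 0`.

Leans on (for the stub provers): `Literature…BoseGas.hasSum_sq_cellFourierCoeff_of_lintegral` /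
`tsum_sq_cellFourierCoeff` (Parseval on the cell `[0,L')³`, transport by the translation `x ↦ x − εL·𝟙`),
`cellWave_apply` (`e_n(x) = exp(2πi n·x/L')` — the stub's mode is `e_k(x − a)·e^{2πik·a/L'}/√(L'^3)`,
a unimodular multiple), `MeasureTheory.lintegral_tsum`, `MeasureTheory.measurePreserving_piFinSuccAbove`
(`Fin.cons`/`Matrix.vecCons` Fubini), `MeasureTheory.measurePreserving_piCongrLeft` + `TrialState.symm`
(Bose symmetry `Σ_i = N·(i=0)`), `ENNReal.lintegral_Lp_add_le` (Minkowski, `p = 2`) and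
`ENNReal.lintegral_mul_le_Lp_mul_Lq` (Cauchy–Schwarz on the shell); torus analogue of the whole counting
step: `Theorems/BECGroundStateSOSIRModeCounting.lean` (`IRModeCounting_proof`, `condensate_ge_half`).

BC3 audit (planner folder `bc/`, 2026-08-17, farm `lean check --json`): this file rc 0, errors [], sorries 2 —
the two `declaration uses sorry` warnings sit exactly at `stub_innerSumRule` and `stub_shellTransfer`, zero
elsewhere; `#print axioms BecDepletionCounting_of` = [propext, Classical.choice, Quot.sound] (no `sorryAx`).
Probes (`bc/InnerSumRule_probe.lean`, `bc/ShellTransfer_probe.lean`: the stub STATEMENT only + 12 examples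
each under `maxHeartbeats 400000`): for each stub `S`, `S → BecDepletionCounting` and
`S → _root_.BoseEinsteinCondensation` by `first | exact? | simpa [S] | (unfold S; simpa) | aesop`, by
`first | exact? | simpa | aesop`, and by each alternative alone — ALL FAIL (rc 1, 12 errors = 12 examples per
file: `unsolved goals` / `exact? could not close the goal` / `Tactic 'assumption' failed` / `aesop: failed to
prove the goal after exhaustive search`): 24/24 probes fail, no stub is cheaply the crux or the summit.
-/

noncomputable section

namespace Summit.AtomisticToContinuum.BoseEinsteinCondensation.Cruxes.BecDepletionCounting.Birth

open MeasureTheory Filter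
open scoped ENNReal NNReal ComplexConjugate BigOperators
open Literature.MathematicalPhysics.QuantumManyBody.BoseGas
open Summit.AtomisticToContinuum.BoseEinsteinCondensation.Theses.BECInfraredBound

/-! ## Stub statements -/

/-- **Stub 1 — inner-box sum rule (Parseval on the inner cube + Bose symmetry).** For every particle
number `N`, box side `L > 0`, margin `ε ∈ (0,1/4)` and every admissible trial state `Ψ` in `Λ_L`:
with the inner cube `Λ' = (εL, L−εL)³` of side `L' = (1−2ε)L` and its plane waves
`φ'_k = L'^{-3/2} e^{2πi k·x/L'} 1_{Λ'}` (`k ∈ ℤ³`), the occupations of the zero mode and of all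
non-zero modes together with the shell mass `N_shell = Σ_i ∫ 1[x_i ∉ Λ'] |Ψ|²` add up to `N`:
`⟨φ'_0,γ_Ψφ'_0⟩ + Σ'_{k≠0} ⟨φ'_k,γ_Ψφ'_k⟩ + N_shell = N` (DLS sum rule `Σ_k ⟨φ'_k,γφ'_k⟩ = tr 1_{Λ'}γ`). -/
def InnerSumRule : Prop :=
  ∀ (N : ℕ) (L ε : ℝ), 0 < L → 0 < ε → ε < 1 / 4 → ∀ Ψ : TrialState N L,
    occupation N ({x : EuclideanSpace ℝ (Fin 3) | ∀ j, x j ∈ Set.Ioo (ε * L) (L - ε * L)}.indicator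
        fun _ => ((Real.sqrt (((1 - 2 * ε) * L) ^ 3))⁻¹ : ℂ)) Ψ.ψ
      + (∑' k : {k : Fin 3 → ℤ // k ≠ 0}, occupation N
          ({x : EuclideanSpace ℝ (Fin 3) | ∀ j, x j ∈ Set.Ioo (ε * L) (L - ε * L)}.indicator
            fun x => ((Real.sqrt (((1 - 2 * ε) * L) ^ 3))⁻¹ : ℂ) *
              Complex.exp (Complex.I * ↑(2 * Real.pi / ((1 - 2 * ε) * L) * ∑ j, (k.1 j : ℝ) * x j)))
          Ψ.ψ)
      + ∑ i : Fin N, ∫⁻ X, {x : EuclideanSpace ℝ (Fin 3) | ∀ j, x j ∈ Set.Ioo (ε * L) (L - ε * L)}ᶜ.indicator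
          (fun _ => (1 : ENNReal)) (X i) * (‖Ψ.ψ X‖₊ : ENNReal) ^ 2
      = (N : ℝ≥0∞)

/-- **Stub 2 — shell transfer (seminorm step).** For every `N`, `L > 0`, `ε ∈ (0,1/4)` and every
admissible `Ψ`: `√⟨·,γ_Ψ ·⟩` is a seminorm on modes, the full-box constant mode splits as
`φ₀ = L^{-3/2} 1_Λ = (1−2ε)^{3/2} φ'_0 + w` with `w = L^{-3/2} 1_{Λ∖Λ'}`, and Cauchy–Schwarz on the shell
gives `⟨w,γw⟩ ≤ L^{-3}|Λ∖Λ'| N_shell ≤ 6ε N_shell`; hence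
`(1−2ε)³ ⟨φ'_0,γ_Ψφ'_0⟩ ≤ 2⟨φ₀,γ_Ψφ₀⟩ + 12ε N_shell`. -/
def ShellTransfer : Prop :=
  ∀ (N : ℕ) (L ε : ℝ), 0 < L → 0 < ε → ε < 1 / 4 → ∀ Ψ : TrialState N L,
    ENNReal.ofReal ((1 - 2 * ε) ^ 3) *
        occupation N ({x : EuclideanSpace ℝ (Fin 3) | ∀ j, x j ∈ Set.Ioo (ε * L) (L - ε * L)}.indicator
          fun _ => ((Real.sqrt (((1 - 2 * ε) * L) ^ 3))⁻¹ : ℂ)) Ψ.ψ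
      ≤ 2 * occupation N ((box L).indicator fun _ => ((Real.sqrt (L ^ 3))⁻¹ : ℂ)) Ψ.ψ
        + ENNReal.ofReal (12 * ε) *
          ∑ i : Fin N, ∫⁻ X, {x : EuclideanSpace ℝ (Fin 3) | ∀ j, x j ∈ Set.Ioo (ε * L) (L - ε * L)}ᶜ.indicator
            (fun _ => (1 : ENNReal)) (X i) * (‖Ψ.ψ X‖₊ : ENNReal) ^ 2

/-! ## Registered stubs -/

/-- stub 1: the inner-box sum rule (Parseval on the translated cube inside `occupation`). -/
theorem stub_innerSumRule : InnerSumRule := by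
  sorry

/-- stub 2: the shell transfer `(1−2ε)³⟨φ'_0,γφ'_0⟩ ≤ 2⟨φ₀,γφ₀⟩ + 12ε N_shell`. -/
theorem stub_shellTransfer : ShellTransfer := by
  sorry

/-! ## Name-keyed aliases of the stub statements — the hypotheses of `BecDepletionCounting_of`

The native skeleton audit (`#h21_check_skeleton`) admits a `Prop` hypothesis of the skeleton theorem only
if its head constant is a registered obligation or is NAMED like a declared stub; `__Registered.stub_X`
is the statement of `stub_X` under that name (device of `Cruxes/AmplitudeLDP/Lines/birth.lean`). Each
alias is `rfl`-equal to its statement. -/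
namespace __Registered

/-- Alias of `InnerSumRule` keyed by the registered stub name. -/
abbrev stub_innerSumRule : Prop := InnerSumRule
/-- Alias of `ShellTransfer` keyed by the registered stub name. -/
abbrev stub_shellTransfer : Prop := ShellTransfer

end __Registered

/-! ## The real arithmetic of the counting step (proved) -/

/-- From the sum rule `O' + S + M = N`, the depletion bound `S ≤ θN` (`0 ≤ θ ≤ 1 − s`), the shell bound
`M ≤ CεN` and the transfer `(1−2ε)³ O' ≤ 2 O + 12ε M`, with `ε ≤ 1/8` and `Cε ≤ s/16`:
`O ≥ ½[(1−2ε)³(1−θ−Cε) − 12Cε²] N ≥ (309/2048) s N ≥ s N / 8`. -/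
theorem zeroMode_lower_arith {O O' S M : ℝ≥0∞} {N : ℕ} {C ε s θ : ℝ}
    (hε0 : 0 < ε) (hε8 : ε ≤ 1 / 8) (hs0 : 0 < s) (hθ0 : 0 ≤ θ) (hθs : θ ≤ 1 - s)
    (hC0 : 0 < C) (hCε : C * ε ≤ s / 16)
    (h1 : O' + S + M = (N : ℝ≥0∞))
    (h2 : S ≤ ENNReal.ofReal (θ * N))
    (h3 : M ≤ ENNReal.ofReal (C * ε * N))
    (h4 : ENNReal.ofReal ((1 - 2 * ε) ^ 3) * O' ≤ 2 * O + ENNReal.ofReal (12 * ε) * M) :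
    ENNReal.ofReal (s / 8 * N) ≤ O := by
  rcases eq_or_ne O ⊤ with hO | hO
  · rw [hO]; exact le_top
  -- finiteness of the three summands of the sum rule
  have hO'T : O' ≠ ⊤ := by
    intro h; rw [h, top_add, top_add] at h1; exact ENNReal.top_ne_natCast N h1
  have hST : S ≠ ⊤ := by
    intro h; rw [h, add_top, top_add] at h1; exact ENNReal.top_ne_natCast N h1
  have hMT : M ≠ ⊤ := by
    intro h; rw [h, add_top] at h1; exact ENNReal.top_ne_natCast N h1
  -- pass to real numbers
  have e1 : O'.toReal + S.toReal + M.toReal = N := by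
    have := congrArg ENNReal.toReal h1
    rwa [ENNReal.toReal_add (ENNReal.add_ne_top.2 ⟨hO'T, hST⟩) hMT, ENNReal.toReal_add hO'T hST,
      ENNReal.toReal_natCast] at this
  have e2 : S.toReal ≤ θ * N := ENNReal.toReal_le_of_le_ofReal (by positivity) h2
  have e3 : M.toReal ≤ C * ε * N := ENNReal.toReal_le_of_le_ofReal (by positivity) h3
  have hA0 : 0 ≤ (1 - 2 * ε) ^ 3 := by
    have : 0 ≤ 1 - 2 * ε := by linarith
    positivity
  have h2O : (2 : ℝ≥0∞) * O ≠ ⊤ := ENNReal.mul_ne_top (by norm_num) hO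
  have h12M : ENNReal.ofReal (12 * ε) * M ≠ ⊤ := ENNReal.mul_ne_top ENNReal.ofReal_ne_top hMT
  have e4 : (1 - 2 * ε) ^ 3 * O'.toReal ≤ 2 * O.toReal + 12 * ε * M.toReal := by
    have := ENNReal.toReal_mono (ENNReal.add_ne_top.2 ⟨h2O, h12M⟩) h4
    rwa [ENNReal.toReal_mul, ENNReal.toReal_ofReal hA0, ENNReal.toReal_add h2O h12M,
      ENNReal.toReal_mul, ENNReal.toReal_mul, ENNReal.toReal_ofReal (by positivity),
      ENNReal.toReal_ofNat] at this
  refine ENNReal.ofReal_le_of_le_toReal ?_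
  -- the real inequality
  have hN : (0 : ℝ) ≤ N := Nat.cast_nonneg N
  have hA27 : (27 / 64 : ℝ) ≤ (1 - 2 * ε) ^ 3 := by
    have h34 : (3 / 4 : ℝ) ≤ 1 - 2 * ε := by linarith
    have : (27 / 64 : ℝ) = (3 / 4) ^ 3 := by norm_num
    rw [this]
    exact pow_le_pow_left₀ (by norm_num) h34 3
  generalize hA : (1 - 2 * ε) ^ 3 = A at e4 hA0 hA27
  have hgap : 0 ≤ (N : ℝ) - θ * N - C * ε * N := by
    have : 0 ≤ 1 - θ - C * ε := by linarith
    nlinarith [mul_nonneg hN this]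
  have ho' : (N : ℝ) - θ * N - C * ε * N ≤ O'.toReal := by linarith
  have h5 : A * ((N : ℝ) - θ * N - C * ε * N) ≤ A * O'.toReal := mul_le_mul_of_nonneg_left ho' hA0
  have h6 : ε * M.toReal ≤ ε * (C * ε * N) := mul_le_mul_of_nonneg_left e3 hε0.le
  have h7 : (27 / 64 : ℝ) * ((N : ℝ) - θ * N - C * ε * N) ≤ A * ((N : ℝ) - θ * N - C * ε * N) :=
    mul_le_mul_of_nonneg_right hA27 hgap
  have h8 : θ * N ≤ (1 - s) * N := mul_le_mul_of_nonneg_right hθs hN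
  have h9 : C * ε * N ≤ s / 16 * N := mul_le_mul_of_nonneg_right hCε hN
  have h10 : ε * (C * ε * N) ≤ (1 / 8) * (s / 16 * N) :=
    mul_le_mul hε8 h9 (by positivity) (by norm_num)
  have hsN : 0 ≤ s * N := mul_nonneg hs0.le hN
  nlinarith [h5, h6, h7, h8, h9, h10, hsN, e4]

/-! ## Composition: the crux BY NAME from the two stub statements (no `sorry` below) -/

/-- **BecDepletionCounting_of** — sum rule (stub 1) + shell transfer (stub 2) ⟹ the crux. Given the
depletion exponent `θ < 1` and the shell constant `C`, put `θ⁺ = max θ 0`, `s = 1 − θ⁺`, fix the margin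
`ε = min(1/8, s/(16C))`, take `ρ₀ = min` of the two thresholds at this `ε`, `c = s/8`, intersect the two
eventualities with `N ≥ 1`, `δ = min δ₁ δ₂`, apply both stubs at `L = (N/ρ)^{1/3}` and conclude by
`zeroMode_lower_arith`. Hypotheses = the two stub statements under their registered names
(`__Registered.stub_X` is `X` by `rfl`); conclusion = the route decl, by name. -/
theorem BecDepletionCounting_of (hP : __Registered.stub_innerSumRule)
    (hT : __Registered.stub_shellTransfer) :
    Summit.AtomisticToContinuum.BoseEinsteinCondensation.Theses.BECInfraredBound.BecDepletionCounting := by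
  intro v hv hD hS
  obtain ⟨θ, hθ1, HD⟩ := hD
  obtain ⟨C, hC0, HS⟩ := hS
  -- the slack `s = 1 - max θ 0`
  obtain ⟨s, hs0, hθs, hθs'⟩ : ∃ s : ℝ, 0 < s ∧ max θ 0 ≤ 1 - s ∧ s ≤ 1 :=
    ⟨1 - max θ 0, by have := max_lt hθ1 one_pos; linarith, le_of_eq (by ring),
      by have := le_max_right θ 0; linarith⟩
  -- the margin `ε = min (1/8) (s / (16 C))`
  obtain ⟨ε, hε0, hε8, hCε⟩ : ∃ ε : ℝ, 0 < ε ∧ ε ≤ 1 / 8 ∧ C * ε ≤ s / 16 := by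
    refine ⟨min (1 / 8) (s / (16 * C)), lt_min (by norm_num) (by positivity), min_le_left _ _, ?_⟩
    calc C * min (1 / 8) (s / (16 * C)) ≤ C * (s / (16 * C)) :=
          mul_le_mul_of_nonneg_left (min_le_right _ _) hC0.le
      _ = s / 16 := by field_simp
  have hε4 : ε < 1 / 4 := by linarith
  obtain ⟨ρ₁, hρ₁, H1⟩ := HD ε hε0 hε4
  obtain ⟨ρ₂, hρ₂, H2⟩ := HS ε hε0 hε4
  refine ⟨min ρ₁ ρ₂, lt_min hρ₁ hρ₂, fun ρ hρ hρlt => ⟨s / 8, by positivity, ?_⟩⟩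
  filter_upwards [H1 ρ hρ (lt_of_lt_of_le hρlt (min_le_left _ _)),
    H2 ρ hρ (lt_of_lt_of_le hρlt (min_le_right _ _)), Filter.eventually_ge_atTop 1]
    with N hN1 hN2 hNpos
  obtain ⟨δ₁, hδ₁, HΨ1⟩ := hN1
  obtain ⟨δ₂, hδ₂, HΨ2⟩ := hN2
  refine ⟨min δ₁ δ₂, lt_min hδ₁ hδ₂, fun Ψ hΨ => ?_⟩
  have hΨ1 := HΨ1 Ψ (hΨ.trans (add_le_add le_rfl (min_le_left _ _)))
  have hΨ2 := HΨ2 Ψ (hΨ.trans (add_le_add le_rfl (min_le_right _ _)))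
  have hL : 0 < sideLength ρ N :=
    Real.rpow_pos_of_pos (div_pos (by exact_mod_cast hNpos) hρ) _
  have hθN : ENNReal.ofReal (θ * N) ≤ ENNReal.ofReal (max θ 0 * N) :=
    ENNReal.ofReal_le_ofReal (mul_le_mul_of_nonneg_right (le_max_left θ 0) (Nat.cast_nonneg N))
  exact zeroMode_lower_arith hε0 hε8 hs0 (le_max_right θ 0) hθs hC0 hCε
    (hP N (sideLength ρ N) ε hL hε0 hε4 Ψ) (hΨ1.trans hθN) hΨ2
    (hT N (sideLength ρ N) ε hL hε0 hε4 Ψ)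

/-- Wiring check (an `example`, so that `BecDepletionCounting_of` stays the only theorem concluding the
crux): the registered stubs feed the skeleton theorem as stated — this term becomes the crux proof when
the two `sorry`s above are discharged. -/
example : Summit.AtomisticToContinuum.BoseEinsteinCondensation.Theses.BECInfraredBound.BecDepletionCounting :=
  BecDepletionCounting_of stub_innerSumRule stub_shellTransfer

/-- The plain-arrow form `<stub sigs> → BecDepletionCounting` of the skeleton theorem (same term). -/
example : InnerSumRule → ShellTransfer →
    Summit.AtomisticToContinuum.BoseEinsteinCondensation.Theses.BECInfraredBound.BecDepletionCounting :=
  BecDepletionCounting_of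

end Summit.AtomisticToContinuum.BoseEinsteinCondensation.Cruxes.BecDepletionCounting.Birth

end
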